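import Literature.MathematicalPhysics.QuantumManyBody.SwapPurity
import Literature.MathematicalPhysics.QuantumManyBody.PeriodicHeatFlowSpectral
import Literature.MathematicalPhysics.QuantumManyBody.CondensateOccupationStability
import Mathlib.InformationTheory.KullbackLeibler.Basic

/-!
# Route `BECThomsonPrinciple`, crux `PeriodicToDirichlet` (stmt-AtomisticToContinuum-9483),
# line `entropy-swap` — vocabulary and registered stub statements

`Defs` file of the crux line `entropy-swap` (idea card
`Summits/AtomisticToContinuum/BoseEinsteinCondensation/Cruxes/PeriodicToDirichlet/Ideas/entropy-budget-swap-transfer.md`,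
skeleton `…/Cruxes/PeriodicToDirichlet/Lines/entropy_swap.lean`, lead seat c2). The line: Dirichlet
ground-state BEC from periodic BEC (`A = PeriodicBEC`) by the relative-entropy method — `A` gives a
floor on the swap purity `tr γ_Φ²/N² = E_{P⊗P}[σ_Φ]` of the torus ground state `Φ` (two independent
baths `P⊗P`), a sub-extensive entropy budget `KL(Q‖P) = o(N)` for the bath law `Q` of every Dirichlet
near-minimiser forbids `Q⊗Q` to charge the `P⊗P`-exponentially-rare event "`σ_Φ` small", and overlap
stability `σ_Ψ ≳ κ σ_Φ` in `Q⊗Q`-measure turns this into a swap-purity floor for `Ψ`, hence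
`λ_max(γ_Ψ) ≥ N · swapPurity ≥ c''N` (Penrose–Onsager) for all near-minimisers. This file holds

* the OBJECTS the line posits: the bath law `bathMeasure n Ψ` (the `n`-particle marginal of `|Ψ|²`,
  first particle integrated out), the conditional overlap `condOverlap n Ψ Y Y'` of the slices
  `ψ_Y = Ψ(·, Y)`, and `cellState n L Φ` (a real torus function cut to the fundamental cell);
* their basic API (total mass / probability, joint measurability, Tonelli, `σ ≤ 1`, normalisation
  of the cell state of a Feynman–Kac torus ground state; the product form
  `swapPurity n Ψ = ∫ σ_Ψ d(Q⊗Q)` is the landed stub `stub_swapPurityDisintegration` + Tonelli);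
* the one-bath objects of design II: `condFlatness n L Ψ Y` (conditional flatness of a slice,
  `n₀(Ψ) = N · E_Q[κ_Ψ]`: `occupation_constantMode_eq_lintegral_condFlatness`) and `mixedOverlap`;
* the STATEMENTS of the line's research stubs (both designs), as named, deliberately untagged `Prop`s
  (intermediate statements of a proof plan, not results in print; the audit's advisory
  `vendored-fact` class is expected until stub files provide witnesses):
  `EntropyBudget` (R1: the wall's Doob factor costs the bath law of a Dirichlet near-minimiser only
  `o(N)` relative entropy against the bath law of the torus ground state of the SAME `N` particles
  on the torus whose cell is the box — geometry `m = 0`), `TorusOverlapConcentration` (R2: speed-`N`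
  lower tail of `σ_Φ` under `P⊗P`), `OverlapStability` (R3: `σ_Ψ + ε ≥ κ σ_Φ` off `Q⊗Q`-mass `ε`,
  quantifiers `∃ κ ∀ ε`); design II: `TorusFlatnessConcentration` (R2′), `SliceAlignment` (R3″) and the
  provable `FlatnessTransfer`; and the chains' output class `BoundedNontrivialBEC` (dilute BEC for
  every bounded admissible `v` with `∫ v(|x|) dx ≠ 0`).

The compositions (both chains, the smooth-class reduction, the pooled item stmt-11786 for everything
beyond bounded `v`) are `Theorems/BECThomsonPrinciplePeriodicToDirichletEntropySwapReduction.lean`.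

References: Kipnis–Landim 1999, App. 1 Prop. 8.2; Yau 1991; Penrose–Onsager 1956, §4 (5)–(6). -/

noncomputable section

open MeasureTheory Filter InformationTheory
open scoped ENNReal NNReal ComplexConjugate

namespace Summit.AtomisticToContinuum.BoseEinsteinCondensation.EntropySwap

open Literature.MathematicalPhysics.QuantumManyBody.BoseGas

/-! ## Objects -/

/-- **Bath law** of an `(n+1)`-body wave function `Ψ`: the measure on `Config n` with Lebesgue
density `Y ↦ ∫ |Ψ(x :: Y)|² dx` — the law of the last `n` particles ("the bath") under `|Ψ|² dZ`,
the first particle integrated out. For normalised `Ψ` a probability measure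
(`isProbabilityMeasure_bathMeasure`). [folklore] -/
def bathMeasure (n : ℕ) (Ψ : Config (n + 1) → ℂ) : Measure (Config n) :=
  volume.withDensity fun Y => ∫⁻ x, (‖Ψ (Matrix.vecCons x Y)‖₊ : ℝ≥0∞) ^ 2

/-- **Conditional overlap** of the one-body slices `ψ_Y = Ψ(·, Y)`, `ψ_{Y'}` of an `(n+1)`-body
wave function: `σ_Ψ(Y, Y') = |∫ conj Ψ(x,Y') Ψ(x,Y) dx|² / (‖ψ_Y‖₂² ‖ψ_{Y'}‖₂²) = cos² ∠(ψ_Y, ψ_{Y'})`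
(`ℝ≥0∞` division: `0/0 = 0`, so slices of zero norm overlap nothing). Its `Q⊗Q`-mean, `Q` the bath
law, is the swap purity `tr γ_Ψ²/N²` (landed stub `stub_swapPurityDisintegration`). [folklore] -/
def condOverlap (n : ℕ) (Ψ : Config (n + 1) → ℂ) (Y Y' : Config n) : ℝ≥0∞ :=
  (‖∫ x, conj (Ψ (Matrix.vecCons x Y')) * Ψ (Matrix.vecCons x Y)‖₊ : ℝ≥0∞) ^ 2 /
    ((∫⁻ x, (‖Ψ (Matrix.vecCons x Y)‖₊ : ℝ≥0∞) ^ 2) *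
      ∫⁻ x, (‖Ψ (Matrix.vecCons x Y')‖₊ : ℝ≥0∞) ^ 2)

/-- A real torus function cut to the fundamental cell `[0,L)^{3(n+1)}` and read as a complex wave
function on `(ℝ³)^{n+1}` (so that `bathMeasure`, `condOverlap`, `swapPurity`, `occupation` integrate
over the cell). [folklore] -/
def cellState (n : ℕ) (L : ℝ) (Φ : Config (n + 1) → ℝ) : Config (n + 1) → ℂ :=
  (cellN (n + 1) L).indicator fun X => (Φ X : ℂ)

/-- **Conditional flatness** of the slice `ψ_Y = Ψ(·, Y)`: `κ_Ψ(Y) = |⟨φ₀, ψ_Y⟩|² / ‖ψ_Y‖²`,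
`φ₀ = constantMode L` (`0/0 = 0`). Its `Q`-mean is `n₀(Ψ)/N`
(`occupation_constantMode_eq_lintegral_condFlatness`). [folklore] -/
def condFlatness (n : ℕ) (L : ℝ) (Ψ : Config (n + 1) → ℂ) (Y : Config n) : ℝ≥0∞ :=
  (‖∫ x, conj (constantMode L x) * Ψ (Matrix.vecCons x Y)‖₊ : ℝ≥0∞) ^ 2 /
    ∫⁻ x, (‖Ψ (Matrix.vecCons x Y)‖₊ : ℝ≥0∞) ^ 2

/-- **Mixed conditional overlap** of the slices of two wave functions at the SAME bath:
`τ(Y) = |⟨g_Y, f_Y⟩|² / (‖g_Y‖² ‖f_Y‖²)` (`0/0 = 0`). [folklore] -/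
def mixedOverlap (n : ℕ) (G F : Config (n + 1) → ℂ) (Y : Config n) : ℝ≥0∞ :=
  (‖∫ x, conj (G (Matrix.vecCons x Y)) * F (Matrix.vecCons x Y)‖₊ : ℝ≥0∞) ^ 2 /
    ((∫⁻ x, (‖G (Matrix.vecCons x Y)‖₊ : ℝ≥0∞) ^ 2) * ∫⁻ x, (‖F (Matrix.vecCons x Y)‖₊ : ℝ≥0∞) ^ 2)

/-! ## Basic API -/

section Bath

variable {n : ℕ}

/-- Total mass of the bath law is `‖Ψ‖₂²`. [folklore] -/
theorem bathMeasure_univ {Ψ : Config (n + 1) → ℂ} (hΨ : Measurable Ψ) :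
    bathMeasure n Ψ Set.univ = ∫⁻ X, (‖Ψ X‖₊ : ℝ≥0∞) ^ 2 := by
  rw [bathMeasure, withDensity_apply _ MeasurableSet.univ, Measure.restrict_univ,
    lintegral_lintegral_sq_nnnorm_vecCons hΨ]
/-- The bath law of a normalised wave function is a probability measure. [folklore] -/
theorem isProbabilityMeasure_bathMeasure {Ψ : Config (n + 1) → ℂ} (hΨ : Measurable Ψ)
    (h1 : ∫⁻ X, (‖Ψ X‖₊ : ℝ≥0∞) ^ 2 = 1) : IsProbabilityMeasure (bathMeasure n Ψ) :=
  ⟨by rw [bathMeasure_univ hΨ, h1]⟩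

/-- The slice pairing `(Y, Y') ↦ ⟨ψ_{Y'}, ψ_Y⟩` is jointly measurable. [folklore] -/
theorem measurable_slicePairing {Ψ : Config (n + 1) → ℂ} (hΨ : Measurable Ψ) :
    Measurable fun p : Config n × Config n =>
      ∫ x, conj (Ψ (Matrix.vecCons x p.2)) * Ψ (Matrix.vecCons x p.1) := by
  have heq : (fun p : Config n × Config n =>
      ∫ x, conj (Ψ (Matrix.vecCons x p.2)) * Ψ (Matrix.vecCons x p.1)) =
      fun p => ∫ x, Ψ (Matrix.vecCons x p.1) * conj (Ψ (Matrix.vecCons x p.2)) := by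
    funext p
    exact integral_congr_ae (ae_of_all _ fun x => mul_comm _ _)
  rw [heq]
  exact measurable_swapKernel hΨ

/-- The conditional overlap is jointly measurable. [folklore] -/
theorem measurable_condOverlap {Ψ : Config (n + 1) → ℂ} (hΨ : Measurable Ψ) :
    Measurable fun p : Config n × Config n => condOverlap n Ψ p.1 p.2 := by
  have hm := measurable_lintegral_sq_nnnorm_vecCons hΨ
  unfold condOverlap
  exact ((measurable_slicePairing hΨ).nnnorm.coe_nnreal_ennreal.pow_const 2).div
    ((hm.comp measurable_fst).mul (hm.comp measurable_snd))

/-- Cauchy–Schwarz: the conditional overlap is at most one (`cos² ≤ 1`; the degenerate cases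
`0/0`, `·/⊤` give `0`). [folklore] -/
theorem condOverlap_le_one {Ψ : Config (n + 1) → ℂ} (hΨ : Measurable Ψ) (Y Y' : Config n) :
    condOverlap n Ψ Y Y' ≤ 1 := by
  unfold condOverlap
  set a := ∫⁻ x, (‖Ψ (Matrix.vecCons x Y)‖₊ : ℝ≥0∞) ^ 2 with ha
  set b := ∫⁻ x, (‖Ψ (Matrix.vecCons x Y')‖₊ : ℝ≥0∞) ^ 2 with hb
  have hCS : (‖∫ x, conj (Ψ (Matrix.vecCons x Y')) * Ψ (Matrix.vecCons x Y)‖₊ : ℝ≥0∞) ^ 2 ≤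
      a * b := by
    have h := sq_nnnorm_integral_mul_conj_le (ν := (volume : Measure Space))
      (measurable_comp_vecCons_left hΨ Y).aemeasurable
      (measurable_comp_vecCons_left hΨ Y').aemeasurable
    have heq : (∫ x, conj (Ψ (Matrix.vecCons x Y')) * Ψ (Matrix.vecCons x Y)) =
        ∫ x, Ψ (Matrix.vecCons x Y) * conj (Ψ (Matrix.vecCons x Y')) :=
      integral_congr_ae (ae_of_all _ fun x => mul_comm _ _)
    rw [heq]
    exact h
  rcases eq_or_ne (a * b) 0 with h0 | h0
  · rw [h0] at hCS
    rw [nonpos_iff_eq_zero.1 hCS, ENNReal.zero_div]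
    exact zero_le_one
  rcases eq_or_ne (a * b) ⊤ with ht | ht
  · rw [ht, ENNReal.div_top]
    exact zero_le_one
  exact ENNReal.div_le_of_le_mul (by rwa [one_mul])

/-- Product form of the disintegration: `∫ σ d(μ ⊗ μ) = ∫∫ σ dμ dμ` (Tonelli). [folklore] -/
theorem lintegral_prod_condOverlap {Ψ : Config (n + 1) → ℂ} (hΨ : Measurable Ψ)
    (μ : Measure (Config n)) [SFinite μ] :
    ∫⁻ p, condOverlap n Ψ p.1 p.2 ∂(μ.prod μ) = ∫⁻ Y, ∫⁻ Y', condOverlap n Ψ Y Y' ∂μ ∂μ :=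
  lintegral_prod _ (measurable_condOverlap hΨ).aemeasurable

/-- The cell state of a measurable real function is measurable. [folklore] -/
theorem measurable_cellState {L : ℝ} {Φ : Config (n + 1) → ℝ} (hΦ : Measurable Φ) :
    Measurable (cellState n L Φ) :=
  (Complex.measurable_ofReal.comp hΦ).indicator (measurableSet_cellN _ _)

/-- The cell state of a Feynman–Kac torus ground state is normalised on `(ℝ³)^{n+1}`. [folklore] -/
theorem lintegral_cellState_sq {v : ℝ → ℝ≥0∞} {L : ℝ} {Φ : Config (n + 1) → ℝ}
    (hΦ : IsPeriodicGroundStateFK v L Φ) :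
    ∫⁻ X, (‖cellState n L Φ X‖₊ : ℝ≥0∞) ^ 2 = 1 := by
  have hpt : ∀ X, (‖cellState n L Φ X‖₊ : ℝ≥0∞) ^ 2 =
      (cellN (n + 1) L).indicator (fun X => ENNReal.ofReal (Φ X) ^ 2) X := by
    intro X
    unfold cellState
    by_cases hX : X ∈ cellN (n + 1) L
    · have h1 : ((‖(Φ X : ℂ)‖₊ : ℝ≥0∞)) = ENNReal.ofReal (Φ X) := by
        rw [show ((‖(Φ X : ℂ)‖₊ : ℝ≥0∞)) = ‖(Φ X : ℂ)‖ₑ from rfl, ← ofReal_norm,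
          Complex.norm_real, Real.norm_of_nonneg (hΦ.nonneg X)]
      rw [Set.indicator_of_mem hX, Set.indicator_of_mem hX, h1]
    · simp [hX]
  simp_rw [hpt]
  rw [lintegral_indicator (measurableSet_cellN _ _), hΦ.norm_eq]

/-- `n₀(Φ)` read on the cell = occupation of the constant mode in the cell state (`rfl`). [folklore] -/
theorem condensateOccupation_eq_occupation_cellState (L : ℝ) (Φ : Config (n + 1) → ℝ) :
    condensateOccupation (n + 1) L (fun X => (Φ X : ℂ)) =
      occupation (n + 1) (constantMode L) (cellState n L Φ) := rfl

/-- The flat pairing of a zero slice vanishes. [folklore] -/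
theorem integral_conj_constantMode_mul_eq_zero {L : ℝ} {Ψ : Config (n + 1) → ℂ}
    (hΨ : Measurable Ψ) (Y : Config n) (h0 : ∫⁻ x, (‖Ψ (Matrix.vecCons x Y)‖₊ : ℝ≥0∞) ^ 2 = 0) :
    ∫ x, conj (constantMode L x) * Ψ (Matrix.vecCons x Y) = 0 := by
  have hae : ∀ᵐ x : Space, Ψ (Matrix.vecCons x Y) = 0 := by
    have h := (lintegral_eq_zero_iff
      ((measurable_comp_vecCons_left hΨ Y).nnnorm.coe_nnreal_ennreal.pow_const 2)).1 h0
    filter_upwards [h] with x hx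
    simpa using hx
  refine integral_eq_zero_of_ae ?_
  filter_upwards [hae] with x hx
  simp [hx]

/-- **One-bath disintegration**: `occupation N φ₀ Ψ = N ∫ κ_Ψ dQ` for `Ψ ∈ L²` (the expected
constant-mode occupation is `N` times the mean conditional flatness of a slice over the bath law).
[cite: PenroseOnsager1956, §4 (5)–(6)] -/
theorem occupation_constantMode_eq_lintegral_condFlatness (L : ℝ) {Ψ : Config (n + 1) → ℂ}
    (hΨ : Measurable Ψ) (hfin : (∫⁻ X, (‖Ψ X‖₊ : ℝ≥0∞) ^ 2) ≠ ⊤) :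
    occupation (n + 1) (constantMode L) Ψ =
      ((n + 1 : ℕ) : ℝ≥0∞) * ∫⁻ Y, condFlatness n L Ψ Y ∂(bathMeasure n Ψ) := by
  have hmm : Measurable fun Y : Config n =>
      ∫⁻ x : Space, (‖Ψ (Matrix.vecCons x Y)‖₊ : ℝ≥0∞) ^ 2 :=
    measurable_lintegral_sq_nnnorm_vecCons hΨ
  have hae : ∀ᵐ Y : Config n, (∫⁻ x : Space, (‖Ψ (Matrix.vecCons x Y)‖₊ : ℝ≥0∞) ^ 2) < ⊤ :=
    ae_lt_top hmm (by rwa [lintegral_lintegral_sq_nnnorm_vecCons hΨ])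
  rw [bathMeasure, lintegral_withDensity_eq_lintegral_mul_non_measurable _ hmm hae]
  have hocc : occupation (n + 1) (constantMode L) Ψ = ((n + 1 : ℕ) : ℝ≥0∞) *
      ∫⁻ Y : Config n, (‖∫ x, conj (constantMode L x) * Ψ (Matrix.vecCons x Y)‖₊ : ℝ≥0∞) ^ 2 := by
    push_cast
    rfl
  rw [hocc]
  congr 1
  refine lintegral_congr_ae ?_
  filter_upwards [hae] with Y hY
  simp only [Pi.mul_apply, condFlatness]
  refine (ENNReal.mul_div_cancel' (fun h0 => ?_) (fun htop => absurd htop hY.ne)).symm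
  rw [integral_conj_constantMode_mul_eq_zero hΨ Y h0]
  simp


/-- Measurability of the flat pairing `Y ↦ ⟨φ₀, ψ_Y⟩`. [folklore] -/
theorem measurable_flatPairing (L : ℝ) {Ψ : Config (n + 1) → ℂ} (hΨ : Measurable Ψ) :
    Measurable fun Y : Config n => ∫ x, conj (constantMode L x) * Ψ (Matrix.vecCons x Y) := by
  have hG : Measurable fun q : Config n × Space =>
      conj (constantMode L q.2) * Ψ (Matrix.vecCons q.2 q.1) :=
    (Complex.continuous_conj.measurable.comp ((measurable_constantMode L).comp measurable_snd)).mul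
      (hΨ.comp (measurable_vecCons.comp (measurable_snd.prodMk measurable_fst)))
  exact (hG.stronglyMeasurable.integral_prod_right' (ν := (volume : Measure Space))).measurable

/-- The conditional flatness is measurable. [folklore] -/
theorem measurable_condFlatness (L : ℝ) {Ψ : Config (n + 1) → ℂ} (hΨ : Measurable Ψ) :
    Measurable (condFlatness n L Ψ) := by
  unfold condFlatness
  exact ((measurable_flatPairing L hΨ).nnnorm.coe_nnreal_ennreal.pow_const 2).div
    (measurable_lintegral_sq_nnnorm_vecCons hΨ)

/-- Measurability of the mixed pairing `Y ↦ ⟨g_Y, f_Y⟩`. [folklore] -/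
theorem measurable_mixedPairing {G F : Config (n + 1) → ℂ} (hG : Measurable G)
    (hF : Measurable F) :
    Measurable fun Y : Config n =>
      ∫ x, conj (G (Matrix.vecCons x Y)) * F (Matrix.vecCons x Y) := by
  have hK : Measurable fun q : Config n × Space =>
      conj (G (Matrix.vecCons q.2 q.1)) * F (Matrix.vecCons q.2 q.1) :=
    (Complex.continuous_conj.measurable.comp
      (hG.comp (measurable_vecCons.comp (measurable_snd.prodMk measurable_fst)))).mul
      (hF.comp (measurable_vecCons.comp (measurable_snd.prodMk measurable_fst)))
  exact (hK.stronglyMeasurable.integral_prod_right' (ν := (volume : Measure Space))).measurable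

/-- The mixed overlap is measurable. [folklore] -/
theorem measurable_mixedOverlap {G F : Config (n + 1) → ℂ} (hG : Measurable G)
    (hF : Measurable F) : Measurable (mixedOverlap n G F) := by
  unfold mixedOverlap
  exact ((measurable_mixedPairing hG hF).nnnorm.coe_nnreal_ennreal.pow_const 2).div
    ((measurable_lintegral_sq_nnnorm_vecCons hG).mul (measurable_lintegral_sq_nnnorm_vecCons hF))

end Bath

/-! ## Registered stub statements of the line (research content) -/

/-- **R1 — entropy budget of the wall** (registered stub `stub_entropyBudget`, geometry `m = 0`):
for a BOUNDED admissible `v` with `∫ v(|x|)dx ≠ 0`, at every small density `ρ`, for every `ε > 0`,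
eventually in `N = n+1`, there is a slack `δ > 0` such that for the Feynman–Kac torus ground state
`Φ` (continuous, positive) of `N` particles on the torus of side `ℓ = L_N(ρ)` and EVERY Dirichlet
`δ`-near-minimiser `Ψ` of `N` particles in the box of side `ℓ` (= the cell):
`KL(bath law of Ψ ‖ bath law of Φ|_cell) ≤ ε N`. Heuristic size `O(Nξ/ℓ) = O(N^{2/3})` (one unit
per boundary-layer particle) for `a > 0`; FALSE at `v = 0` (`KL = 3(1 - log 2)N`), whence the
non-triviality hypothesis. No printed source; the naive route (relative Fisher information = energy
excess `o(N)`, times a global log-Sobolev constant `≍ ℓ`) comes out extensive by a hair, so a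
layer-local entropy estimate is required. -/
def EntropyBudget : Prop :=
  ∀ v : ℝ → ℝ≥0∞, IsRepulsiveFiniteRange v → (∃ B : ℝ≥0, ∀ r, 0 ≤ r → v r ≤ B) →
    (∫⁻ x : Space, v ‖x‖) ≠ 0 →
    ∃ ρ₁ : ℝ, 0 < ρ₁ ∧ ∀ ρ : ℝ, 0 < ρ → ρ < ρ₁ → ∀ ε : ℝ, 0 < ε → ∀ᶠ n : ℕ in atTop,
      ∃ δ : ℝ≥0∞, 0 < δ ∧
        ∀ Φ : Config (n + 1) → ℝ, IsPeriodicGroundStateFK v (sideLength ρ (n + 1)) Φ →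
          Continuous Φ → (∀ X, 0 < Φ X) →
        ∀ Ψ : TrialState (n + 1) (sideLength ρ (n + 1)),
          energy v Ψ ≤ groundStateEnergy v (n + 1) (sideLength ρ (n + 1)) + δ →
            klDiv (bathMeasure n Ψ.ψ) (bathMeasure n (cellState n (sideLength ρ (n + 1)) Φ)) ≤
              ENNReal.ofReal (ε * (n + 1))

/-- **R2 — torus overlap concentration** (registered stub `stub_torusOverlapConcentration`): for a
bounded admissible `v`, at every small density, for every fraction `θ ∈ (0,1)` there is a rate
`g > 0` such that eventually in `N`, drawing two independent baths from the torus ground state,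
`(P⊗P){σ_Φ < θ · E_{P⊗P} σ_Φ} ≤ e^{-gN}` — a speed-`N` lower large-deviation bound for a bounded,
bounded-difference functional of two bath configurations (the cheapest way to halve the overlap
is a macroscopic rearrangement of a bath). No printed source for ground-state laws of interacting
gases (transport–entropy inequalities for Gibbs point processes in a uniqueness regime are the
nearest technology, and would require Gibbsian control of `Φ²` that is not available). -/
def TorusOverlapConcentration : Prop :=
  ∀ v : ℝ → ℝ≥0∞, IsRepulsiveFiniteRange v → (∃ B : ℝ≥0, ∀ r, 0 ≤ r → v r ≤ B) →
    ∃ ρ₁ : ℝ, 0 < ρ₁ ∧ ∀ ρ : ℝ, 0 < ρ → ρ < ρ₁ → ∀ θ : ℝ, 0 < θ → θ < 1 →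
      ∃ g : ℝ, 0 < g ∧ ∀ᶠ n : ℕ in atTop,
        ∀ Φ : Config (n + 1) → ℝ, IsPeriodicGroundStateFK v (sideLength ρ (n + 1)) Φ →
          Continuous Φ → (∀ X, 0 < Φ X) →
          let Φc := cellState n (sideLength ρ (n + 1)) Φ
          let P := bathMeasure n Φc
          (P.prod P) {p | condOverlap n Φc p.1 p.2 <
              ENNReal.ofReal θ * ∫⁻ q, condOverlap n Φc q.1 q.2 ∂(P.prod P)} ≤
            ENNReal.ofReal (Real.exp (-(g * (n + 1))))

/-- **R3 — overlap stability under the wall's Doob factor** (registered stub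
`stub_overlapStability`; quantifiers `∃ κ ∀ ε` — with `κ` after `ε` the statement would be trivially
true): for a bounded admissible `v` with `∫ v ≠ 0`, at every small density there is `κ > 0` such
that for every `ε > 0`, eventually in `N`, for some slack `δ > 0`, every Dirichlet `δ`-near-minimiser
`Ψ` has `σ_Ψ + ε ≥ κ σ_Φ` off a set of `Q⊗Q`-mass `≤ ε` (`Q` = bath law of `Ψ`, `Φ` the torus ground
state on the cell). Content: at the four-point (swap) level the one-body boundary-layer part of
`Ψ/Φ` cancels and survives only as the flat-on-the-bulk weight of the inner product. No printed
source. -/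
def OverlapStability : Prop :=
  ∀ v : ℝ → ℝ≥0∞, IsRepulsiveFiniteRange v → (∃ B : ℝ≥0, ∀ r, 0 ≤ r → v r ≤ B) →
    (∫⁻ x : Space, v ‖x‖) ≠ 0 →
    ∃ ρ₁ : ℝ, 0 < ρ₁ ∧ ∀ ρ : ℝ, 0 < ρ → ρ < ρ₁ → ∃ κ : ℝ, 0 < κ ∧ ∀ ε : ℝ, 0 < ε →
      ∀ᶠ n : ℕ in atTop, ∃ δ : ℝ≥0∞, 0 < δ ∧
        ∀ Φ : Config (n + 1) → ℝ, IsPeriodicGroundStateFK v (sideLength ρ (n + 1)) Φ →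
          Continuous Φ → (∀ X, 0 < Φ X) →
        ∀ Ψ : TrialState (n + 1) (sideLength ρ (n + 1)),
          energy v Ψ ≤ groundStateEnergy v (n + 1) (sideLength ρ (n + 1)) + δ →
            let Φc := cellState n (sideLength ρ (n + 1)) Φ
            let Q := bathMeasure n Ψ.ψ
            (Q.prod Q) {p | condOverlap n Ψ.ψ p.1 p.2 + ENNReal.ofReal ε <
                ENNReal.ofReal κ * condOverlap n Φc p.1 p.2} ≤ ENNReal.ofReal ε

/-- **R2′ — torus flatness concentration** (registered stub `stub_torusFlatnessConcentration`, design
II): for a bounded admissible `v`, at every small density and fraction `θ ∈ (0,1)` there is a rate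
`g > 0` such that eventually in `N`, under the bath law `P` of the torus ground state on the cell,
`P{κ_Φ < θ · E_P κ_Φ} ≤ e^{-gN}` — a one-bath, speed-`N` lower large-deviation bound for the
conditional flatness ("average flatness ⇒ typical flatness"; the same species as the torus LDP
`K2a` of line `Sketch`). No printed source. -/
def TorusFlatnessConcentration : Prop :=
  ∀ v : ℝ → ℝ≥0∞, IsRepulsiveFiniteRange v → (∃ B : ℝ≥0, ∀ r, 0 ≤ r → v r ≤ B) →
    ∃ ρ₁ : ℝ, 0 < ρ₁ ∧ ∀ ρ : ℝ, 0 < ρ → ρ < ρ₁ → ∀ θ : ℝ, 0 < θ → θ < 1 →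
      ∃ g : ℝ, 0 < g ∧ ∀ᶠ n : ℕ in atTop,
        ∀ Φ : Config (n + 1) → ℝ, IsPeriodicGroundStateFK v (sideLength ρ (n + 1)) Φ →
          Continuous Φ → (∀ X, 0 < Φ X) →
          let Φc := cellState n (sideLength ρ (n + 1)) Φ
          let P := bathMeasure n Φc
          P {Y | condFlatness n (sideLength ρ (n + 1)) Φc Y <
              ENNReal.ofReal θ * ∫⁻ Y', condFlatness n (sideLength ρ (n + 1)) Φc Y' ∂P} ≤
            ENNReal.ofReal (Real.exp (-(g * (n + 1))))

/-- **R3″ — slice alignment** (registered stub `stub_sliceAlignment`, design II): for a bounded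
admissible `v` with `∫ v ≠ 0`, at every small density, for every `η > 0`, eventually in `N`, for some
slack `δ > 0`, every Dirichlet `δ`-near-minimiser `Ψ` has its slice `Ψ(·,Y)` `L²`-aligned up to a
phase with the torus ground state's slice `Φ(·,Y)` at the SAME bath (`|cos ∠|² ≥ 1 - η`) off a set of
`Q`-mass `≤ η`. Content: the Doob factor `Ψ/Φ` is fibrewise a one-body boundary-layer profile
`s(x)` times a bath factor up to small terms, and `s ≠ 1` only on a layer of volume fraction
`O(ξ/L) → 0`, so the ANGLE between the slices vanishes although the profile does not flatten. No
printed source. -/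
def SliceAlignment : Prop :=
  ∀ v : ℝ → ℝ≥0∞, IsRepulsiveFiniteRange v → (∃ B : ℝ≥0, ∀ r, 0 ≤ r → v r ≤ B) →
    (∫⁻ x : Space, v ‖x‖) ≠ 0 →
    ∃ ρ₁ : ℝ, 0 < ρ₁ ∧ ∀ ρ : ℝ, 0 < ρ → ρ < ρ₁ → ∀ η : ℝ, 0 < η →
      ∀ᶠ n : ℕ in atTop, ∃ δ : ℝ≥0∞, 0 < δ ∧
        ∀ Φ : Config (n + 1) → ℝ, IsPeriodicGroundStateFK v (sideLength ρ (n + 1)) Φ →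
          Continuous Φ → (∀ X, 0 < Φ X) →
        ∀ Ψ : TrialState (n + 1) (sideLength ρ (n + 1)),
          energy v Ψ ≤ groundStateEnergy v (n + 1) (sideLength ρ (n + 1)) + δ →
            bathMeasure n Ψ.ψ {Y | mixedOverlap n (cellState n (sideLength ρ (n + 1)) Φ) Ψ.ψ Y <
                ENNReal.ofReal (1 - η)} ≤ ENNReal.ofReal η

/-- **Flatness transfer** (registered stub `stub_flatnessTransfer`, design II, provable): the
Hilbert-space inequality `√κ(f) ≥ √(τκ(g)) − √(1−τ)` with constants baked in — `κ(g) ≥ κ`,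
`τ ≥ 1 − κ/16`, `κ ≤ 1` ⇒ `κ(f) ≥ κ/4` (LANDED p113719,
`Theorems/BECThomsonPrinciplePeriodicToDirichletFlatnessTransfer.lean`). -/
def FlatnessTransfer : Prop :=
  ∀ (n : ℕ) (L : ℝ) (G F : Config (n + 1) → ℂ) (Y : Config n), Measurable G → Measurable F →
    0 < L →
    (∫⁻ x, (‖G (Matrix.vecCons x Y)‖₊ : ℝ≥0∞) ^ 2) ≠ ⊤ →
    (∫⁻ x, (‖F (Matrix.vecCons x Y)‖₊ : ℝ≥0∞) ^ 2) ≠ ⊤ →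
    ∀ κ : ℝ, 0 ≤ κ → κ ≤ 1 →
      ENNReal.ofReal κ ≤ condFlatness n L G Y →
      ENNReal.ofReal (1 - κ / 16) ≤ mixedOverlap n G F Y →
        ENNReal.ofReal (κ / 4) ≤ condFlatness n L F Y

/-- **What the Yau chain delivers**: dilute ground-state BEC for every bounded admissible `v` that
is not trivial at almost every distance (`∫ v(|x|) dx ≠ 0`). -/
def BoundedNontrivialBEC : Prop :=
  ∀ v : ℝ → ℝ≥0∞, IsRepulsiveFiniteRange v → (∃ B : ℝ≥0, ∀ r, 0 ≤ r → v r ≤ B) →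
    (∫⁻ x : Space, v ‖x‖) ≠ 0 →
      ∃ ρ₀ : ℝ, 0 < ρ₀ ∧ ∀ ρ : ℝ, 0 < ρ → ρ < ρ₀ → HasGroundStateBEC v ρ

/-- **Registered sub-goal `stub_oneBathDisintegration`** (this file lands with it): the one-bath
disintegration `n₀(Ψ) = N · E_Q[κ_Ψ]`, unfolded. [cite: PenroseOnsager1956, §4 (5)–(6)] -/
theorem stub_oneBathDisintegration :
    ∀ (n : ℕ) (L : ℝ) (Ψ : Config (n + 1) → ℂ), Measurable Ψ → (∫⁻ X, (‖Ψ X‖₊ : ℝ≥0∞) ^ 2) ≠ ⊤ →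
      occupation (n + 1) (constantMode L) Ψ = ((n + 1 : ℕ) : ℝ≥0∞) *
        ∫⁻ Y, (‖∫ x, (starRingEnd ℂ) (constantMode L x) * Ψ (Matrix.vecCons x Y)‖₊ : ℝ≥0∞) ^ 2 /
            (∫⁻ x, (‖Ψ (Matrix.vecCons x Y)‖₊ : ℝ≥0∞) ^ 2)
          ∂(volume.withDensity fun Y => ∫⁻ x, (‖Ψ (Matrix.vecCons x Y)‖₊ : ℝ≥0∞) ^ 2) :=
  fun _ L _ hΨ hfin => occupation_constantMode_eq_lintegral_condFlatness L hΨ hfin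

end Summit.AtomisticToContinuum.BoseEinsteinCondensation.EntropySwap

end
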